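import Mathlib
import HarnessLib
import Summits.HubbardSuperconductivity.HubbardSuperconductivity.Theorems.KLProgrammeKLRegimeTorusL1SecondDifferences

/-!
# Route `KLProgramme` — engine support, route (L2): the master `ℓ¹` lemma with the RATES SOLVED FOR — from pointwise second-difference
# CONSTANTS `K_t, K₁, K₂, K₃` (time, axes, `v⊥`, `v`) and a sup bound `A₀` to the `ℓ¹` norm of the space-time character sum

Cell `gate-hubbard-kl`, seat p4 (C5a lead), g6.  `sum_norm_charSum_le_of_second_differences` (k3c2-p3) asks for the pointwise bounds in the
form `A₀(4/(s_w P_w))²`; the symbol layer (`…SectorMultiplierDiffs`, `…SectorMultiplierSupport`, and k3c2-p3's propagator files) produces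
plain constants `‖Δ²_w G‖ ≤ K_w`.  Choosing `s_w = 4√(A₀/K_w)/P_w` (so that `A₀(4/(s_wP_w))² = K_w`):
**`sum_norm_charSum_le_of_consts`** — `Σ_z ‖S(z)‖ ≤ √(2048(P√(K_t/A₀)/4 + 1)·[4(2√2·L√(K₂/A₀)/(4|v|) + 2)(2√2·L√(K₃/A₀)/(4|v|) + 2)
+ 16(L√(K₁/A₀)/4 + 1)²/(1 + 4R₀/(L√(K₁/A₀)))]) · √(16·P·L²·N_s) · A₀`.  With the symbol-side scales (`A₀ = 1`, `K_t ≍ (Pε)⁻²…`) this is the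
`B ≍ C·P/β` of HOME/prover-p4/FRAME-L22-NOTE.md §2.  Everything is proved; no definitions, no named facts. [folklore]
-/

noncomputable section

namespace Summit.HubbardSuperconductivity.HubbardSuperconductivity.Theorems.TorusFourierL2

set_option linter.dupNamespace false -- summit = problem name (single-conjunct summit), D-0017

open Finset Literature.Probability.LatticeModels
open scoped Real

/-- The rate that turns a constant bound into the master lemma's form: with `s = 4√(A₀/K)/P`, `A₀(4/(sP))² = K` (`A₀, K, P > 0`). [folklore] -/
theorem rate_identity {A₀ K P : ℝ} (hA : 0 < A₀) (hK : 0 < K) (hP : 0 < P) :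
    0 < 4 * Real.sqrt (A₀ / K) / P ∧ A₀ * (4 / (4 * Real.sqrt (A₀ / K) / P * P)) ^ 2 = K := by
  have hs : 0 < Real.sqrt (A₀ / K) := Real.sqrt_pos.2 (div_pos hA hK)
  refine ⟨by positivity, ?_⟩
  have hsq : Real.sqrt (A₀ / K) ^ 2 = A₀ / K := Real.sq_sqrt (div_pos hA hK).le
  have e : 4 / (4 * Real.sqrt (A₀ / K) / P * P) = 1 / Real.sqrt (A₀ / K) := by field_simp
  rw [e, div_pow, one_pow, hsq]
  field_simp

/-- **The `ℓ¹` norm of a space-time character sum from pointwise second-difference CONSTANTS.**  If `‖G‖ ≤ A₀` (`A₀ > 0`), `#{G ≠ 0} ≤ N_s`,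
`‖Δ²_{(1,0)}G‖ ≤ K_t`, `‖Δ²_{(0,eᵢ)}G‖ ≤ K₁`, `‖Δ²_{(0,v⊥)}G‖ ≤ K₂`, `‖Δ²_{(0,v)}G‖ ≤ K₃` pointwise (`K > 0`), `v ≠ 0`, `2(|v₁|+|v₂|)R₀ < L`, then
`Σ_z ‖S(z)‖ ≤ √(2048(1/s₀+1)[4(2√2/(s₂|v|)+2)(2√2/(s₃|v|)+2) + 16(1/s₁+1)²/(1+s₁R₀)])·√(16PL²N_s)·A₀` with `s₀ = 4√(A₀/K_t)/P`,
`sᵢ = 4√(A₀/Kᵢ)/L`. [cite: BenfattoGiulianiMastropietro2006, §2.6 (2.81) and footnote 1] -/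
theorem sum_norm_charSum_le_of_consts {P L : ℕ} [NeZero P] [NeZero L] (G : TorusSite 1 P × TorusSite 2 L → ℂ)
    (v : Fin 2 → ℤ) (hv : v ≠ 0) {R₀ : ℕ} (hR₀ : 2 * (|v 0| + |v 1|) * (R₀ : ℤ) < L) {A₀ Kt K₁ K₂ K₃ : ℝ} (hA₀ : 0 < A₀)
    (hKt : 0 < Kt) (hK₁ : 0 < K₁) (hK₂ : 0 < K₂) (hK₃ : 0 < K₃) {Ns : ℕ}
    (hsupp : (univ.filter fun q => G q ≠ 0).card ≤ Ns) (hsup : ∀ q, ‖G q‖ ≤ A₀)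
    (h₀ : ∀ q, ‖(fwdDiff ((fun _ : Fin 1 => (1 : ZMod P)), (0 : TorusSite 2 L)))^[2] G q‖ ≤ Kt)
    (h₁ : ∀ q (i : Fin 2), ‖(fwdDiff ((0 : TorusSite 1 P), (Pi.single i (1 : ZMod L) : TorusSite 2 L)))^[2] G q‖ ≤ K₁)
    (h₂ : ∀ q, ‖(fwdDiff ((0 : TorusSite 1 P), (fun j => ((![-v 1, v 0] j : ℤ) : ZMod L))))^[2] G q‖ ≤ K₂)
    (h₃ : ∀ q, ‖(fwdDiff ((0 : TorusSite 1 P), (fun j => ((v j : ℤ) : ZMod L))))^[2] G q‖ ≤ K₃) :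
    ∑ z : TorusSite 1 P × TorusSite 2 L, ‖∑ q : TorusSite 1 P × TorusSite 2 L, (torusChar q.1 z.1 * torusChar q.2 z.2) • G q‖ ≤
      Real.sqrt (2048 * (1 / (4 * Real.sqrt (A₀ / Kt) / P) + 1) *
          (4 * ((2 * Real.sqrt 2 / (4 * Real.sqrt (A₀ / K₂) / L * Real.sqrt ((v 0 : ℝ) ^ 2 + (v 1 : ℝ) ^ 2)) + 2) *
              (2 * Real.sqrt 2 / (4 * Real.sqrt (A₀ / K₃) / L * Real.sqrt ((v 0 : ℝ) ^ 2 + (v 1 : ℝ) ^ 2)) + 2))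
            + 16 * (1 / (4 * Real.sqrt (A₀ / K₁) / L) + 1) ^ 2 / (1 + 4 * Real.sqrt (A₀ / K₁) / L * R₀))) *
        Real.sqrt (16 * P * (L : ℝ) ^ 2 * Ns) * A₀ := by
  have hP : (0 : ℝ) < P := Nat.cast_pos.2 (Nat.pos_of_ne_zero (NeZero.ne P))
  have hL : (0 : ℝ) < L := Nat.cast_pos.2 (Nat.pos_of_ne_zero (NeZero.ne L))
  obtain ⟨hs₀, e₀⟩ := rate_identity hA₀ hKt hP
  obtain ⟨hs₁, e₁⟩ := rate_identity hA₀ hK₁ hL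
  obtain ⟨hs₂, e₂⟩ := rate_identity hA₀ hK₂ hL
  obtain ⟨hs₃, e₃⟩ := rate_identity hA₀ hK₃ hL
  exact sum_norm_charSum_le_of_second_differences G v hv hs₀ hs₁ hs₂ hs₃ hR₀ hA₀.le hsupp hsup
    (fun q => (h₀ q).trans (le_of_eq e₀.symm)) (fun q i => (h₁ q i).trans (le_of_eq e₁.symm))
    (fun q => (h₂ q).trans (le_of_eq e₂.symm)) (fun q => (h₃ q).trans (le_of_eq e₃.symm))

end Summit.HubbardSuperconductivity.HubbardSuperconductivity.Theorems.TorusFourierL2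

end
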